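import Summits.BirchSwinnertonDyer.Rank1Residual.JET.CarrierReadingRecordsKitThree
import Literature.NumberTheory.EllipticCurves.HeegnerPointsOfConductorOneRationalityProofs
import Literature.NumberTheory.EllipticCurves.HeegnerPointsOfConductorOneGaloisConjProofs
import Literature.NumberTheory.EllipticCurves.CuspFormLFunctionLevelConductorProofs
import HarnessLib

/-!
# T1 JET (cell `bsd-jet`): the record kits' displayed binders `hrec`, `hD36` SUPPLIED BY LITERATURE THEOREMS
# and `hlev` REDUCED TO MODULARITY — FED twins of the seven `CarrierReadingRecordsKit[Three]` doors

HONEST FRAMING (programme `BSD-LIT2PART-PROGRAMME-v1.md` §HONESTY, verbatim): «no tranche here proves BSD;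
ARM L moves the LITERAL column of an r ≤ 1 census into the kernel-proved-modulo-named-print column; ARM P
changes what «named print» is worth.» THEOREMS ONLY (no definition, no named fact, no `sorry`); nothing is
booked by this file; nothing about any particular curve is asserted. Seat `bsd-jet-ty` (typer), g6.

WHAT THIS FILE IS. Every by-name JET record `JET.bsdpJ_<label>_<p>` / `JET.bsdp_jr…` landed by this seat
(`JET/JetDocstrikeARecords01–07`, `JetDocstrikeBRecords01–07`, `JetDocstrikeDatumRecords01–13`, the D1-IDX and
R-IDX samples) is ONE application of a record-kit door (`bsdp_of_jetRowA5_tam_min`, `…B5…`, `…A3…`,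
`…A3_tamX…`, `…B3…` of `CarrierReadingRecordsKit`, p468192; `…A3F_tam_min`, `…A3F_tamX_min` of
`CarrierReadingRecordsKitThree`, p469004) to the literal model, and DISPLAYS, besides the reading binder `hJ`
and the published `hMcU` / `hGZK` / `hKo`, three further binders inherited from the Kolyvagin consumer chain:
* `hrec : ∀ N W (K : Type), heegnerPointOfConductor_one_galoisConj N W K` — Shimura reciprocity for `y(1)`
  (Darmon 2004 Thm. 3.7 / Gross 1991 §4), documented in its Literature file as «not provable in the tree
  today»; it IS now a Literature THEOREM: `heegnerPointOfConductor_one_galoisConj_holds`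
  (`HeegnerPointsOfConductorOneGaloisConjProofs.lean`, every `K : Type`);
* `hD36 : ∀ N W (K : Type), phi_heegnerTau_mem_singularModuliField N W K` — Darmon 2004 Thm. 3.6 at
  conductor `1`; now a Literature THEOREM: `phi_heegnerTau_mem_singularModuliField_holds`
  (`HeegnerPointsOfConductorOneRationalityProofs.lean`, every universe);
* `hlev : ∀ {N} [NeZero N], IsNewformOf.level_eq_conductorNorm` — Carayol 1986 (level of the newform =
  conductor); over the tree it «carries no obligation beyond modularity»:
  `IsNewformOf.level_eq_conductorNorm_of_exists_isNewformOf'` (`CuspFormLFunctionLevelConductorProofs.lean`,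
  strong multiplicity one across levels, Atkin–Lehner 1970 Thm. 4, a tree theorem) turns the census-wide
  modularity binder `exists_isNewformOf` (Breuil–Conrad–Diamond–Taylor 2001) into `hlev` at every level.
§0 states the FEEDERS as terms of exactly the displayed binder types (so any ALREADY-LANDED record is fed by
name: `bsdpJ_<label>_<p> hJ hMcU hGZK hKo heegnerPointOfConductor_one_galoisConj_forall
(fun N _ W K _ _ => phi_heegnerTau_mem_singularModuliField_holds N W K)
(level_eq_conductorNorm_forall_of_exists_isNewformOf hmod) W rfl …`; the `hD36` term is the tree's
`GoldfeldGoodTwists.phi_heegnerTau_mem_singularModuliField_all`, cited by name, not re-declared);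
§1–§3 are the FED twins `<door>_fed` of the seven doors: the same statement with `hrec`, `hD36` REMOVED and `hlev`
REPLACED by `hmod : exists_isNewformOf`, proved by the door itself with every explicit binder passed by name.
Net effect on the displayed named print of a JET by-name row: {`hJ`, `hMcU`, `hGZK`, `hKo`, `hrec`, `hD36`,
`hlev`} ↦ {`hJ`, `hMcU`, `hGZK`, `hKo`, `hmod`}. The prover kits' doors (`bsdp_of_jetRowCarrierAdd_three_of_frobenius`,
`bsdp_of_jetRowCarrierMult_of_serreWitnesses` / `_of_ram` / `_of_irr_of_order`) get the same twins in the sibling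
file `CarrierReadingRecordsKitFed Carrier`. PARTITION: row D5 `JET@p∣N` — 0 classes moved by this file (evidence /
ARM-P-type reduction of displayed binders; the desks book).

References: H. Darmon, CBMS 101 (2004) Thm. 3.6 / 3.7 [Darmon2004]; B. H. Gross, LMS LN 153 (1991) §4 [GrossLMS1991];
Atkin–Lehner, Math. Ann. 185 (1970) Thm. 4 [AtkinLehner1970]; Diamond–Shurman, GTM 228 (2005) Thm. 8.8.1
[DiamondShurman2005]; D. Jetchev, Compos. Math. 144 (2008) Thm. 1.4, Cor. 1.5 [Jetchev2008].
-/

set_option autoImplicit false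

noncomputable section

open scoped Classical

open IsDedekindDomain NumberField Rat.HeightOneSpectrum WeierstrassCurve Literature.NumberTheory.EllipticCurves
  Literature.NumberTheory.EllipticCurves.ModularForms
  Literature.NumberTheory.EllipticCurves.Rank1Residual
  Literature.NumberTheory.EllipticCurves.Rank1Residual.Typed
  Literature.NumberTheory.EllipticCurves.Rank1Residual.X11RankOneCertificates
  Summit.BirchSwinnertonDyer.BirchSwinnertonDyer.Rank1Residual
  Summit.BirchSwinnertonDyer.BirchSwinnertonDyer.Rank1Residual.IntModel
  Summit.BirchSwinnertonDyer.BirchSwinnertonDyer.Rank1Residual.X11RankOne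
  Summit.BirchSwinnertonDyer.BirchSwinnertonDyer.Rank2Observatory.Tam
  Summit.BirchSwinnertonDyer.Rank1Residual Summit.BirchSwinnertonDyer.Rank1Residual.X11b

namespace Summit.BirchSwinnertonDyer.Rank1Residual.JET

/-! ## §0 The feeders (terms of the exact binder types displayed by every JET record kit; the `hD36` feeder is the
term `fun N _ W K _ _ => phi_heegnerTau_mem_singularModuliField_holds N W K`, already named in the tree as
`GoldfeldGoodTwists.phi_heegnerTau_mem_singularModuliField_all`, so it is not re-declared here) -/

/-- **`hrec` BY NAME.** Shimura reciprocity for `y(1)` (Darmon 2004 Thm. 3.7 / Gross 1991 §4), in the `∀ (N) (W)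
(K : Type)` shape of the kits' displayed binder `hrec`, from the Literature theorem
`heegnerPointOfConductor_one_galoisConj_holds` (`HeegnerPointsOfConductorOneGaloisConjProofs`).
[cite: Darmon2004, Thm. 3.7 (PDF p. 44)] [cite: GrossLMS1991, §4] -/
theorem heegnerPointOfConductor_one_galoisConj_forall :
    ∀ (N : ℕ) [NeZero N] (W : WeierstrassCurve ℚ) (K : Type) [Field K] [NumberField K],
      heegnerPointOfConductor_one_galoisConj N W K :=
  fun N _ W K _ _ => heegnerPointOfConductor_one_galoisConj_holds N W K

/-- **`hlev` FROM MODULARITY.** Carayol's level theorem `N = N_W` for the newform of `W` at any level, in the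
`∀ {N} [NeZero N]` shape of the kits' displayed binder `hlev`, from the modularity binder
`hmod : exists_isNewformOf` (Breuil–Conrad–Diamond–Taylor) by the Literature theorem
`IsNewformOf.level_eq_conductorNorm_of_exists_isNewformOf'` (strong multiplicity one across levels,
`CuspFormLFunctionLevelConductorProofs`). [cite: DiamondShurman2005, Thm. 8.8.1] [cite: AtkinLehner1970, Thm. 4] -/
theorem level_eq_conductorNorm_forall_of_exists_isNewformOf (hmod : exists_isNewformOf) :
    ∀ {N : ℕ} [NeZero N], IsNewformOf.level_eq_conductorNorm (N := N) :=
  fun {_} _ => IsNewformOf.level_eq_conductorNorm_of_exists_isNewformOf' hmod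

/-! ## §1 `p ≥ 5` (kit `CarrierReadingRecordsKit` §1) -/
/-- **FED twin of `JET.bsdp_of_jetRowA5_tam_min`** — bucket A, `p ≥ 5`, carrier `q ≠ p` split multiplicative
(the kit's §1; 111 landed records): the door's statement with `hrec` / `hD36` SUPPLIED by the Literature
theorems and `hlev` by `hmod : exists_isNewformOf`; every other binder verbatim, by name. -/
theorem bsdp_of_jetRowA5_tam_min_fed
    (p : ℕ) (hp : p.Prime) (hp5 : 5 ≤ p) (a1 a2 a3 a4 a6 : ℤ)
    (hmin : (⟨a1, a2, a3, a4, a6⟩ : WeierstrassCurve ℚ).IsGloballyMinimal) (ℓ₁ ℓ₂ ℓ₃ : ℕ)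
    (hℓ₁ : ℓ₁.Prime) (hℓ₂ : ℓ₂.Prime) (hℓ₃ : ℓ₃.Prime) (h2₁ : ℓ₁ ≠ 2) (h2₂ : ℓ₂ ≠ 2) (h2₃ : ℓ₃ ≠ 2)
    (hne₁ : ℓ₁ ≠ p) (hne₂ : ℓ₂ ≠ p) (hne₃ : ℓ₃ ≠ p) (hΔ₁ : ¬ (ℓ₁ : ℤ) ∣ discOf [a1, a2, a3, a4, a6])
    (hΔ₂ : ¬ (ℓ₂ : ℤ) ∣ discOf [a1, a2, a3, a4, a6])
    (hΔ₃ : ¬ (ℓ₃ : ℤ) ∣ discOf [a1, a2, a3, a4, a6]) {n₁ n₂ n₃ : ℕ}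
    (hc₁ : countPoints [a1, a2, a3, a4, a6] ℓ₁ = n₁)
    (hc₂ : countPoints [a1, a2, a3, a4, a6] ℓ₂ = n₂)
    (hc₃ : countPoints [a1, a2, a3, a4, a6] ℓ₃ = n₃) (r u : ZMod p)
    (hi : (((ℓ₁ : ℤ) + 1 - n₁ : ℤ) : ZMod p) ^ 2 - 4 * ℓ₁ = r * r ∧
      (((ℓ₁ : ℤ) + 1 - n₁ : ℤ) : ZMod p) ^ 2 - 4 * ℓ₁ ≠ 0 ∧ (((ℓ₁ : ℤ) + 1 - n₁ : ℤ) : ZMod p) ≠ 0)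
    (hii : ((((ℓ₂ : ℤ) + 1 - n₂ : ℤ) : ZMod p) ^ 2 - 4 * ℓ₂) ^ (p / 2) = -1 ∧
      (((ℓ₂ : ℤ) + 1 - n₂ : ℤ) : ZMod p) ≠ 0)
    (hiii : (((ℓ₃ : ℤ) + 1 - n₃ : ℤ) : ZMod p) ^ 2 = u * ℓ₃ ∧
      u ≠ 0 ∧ u ≠ 1 ∧ u ≠ 2 ∧ u ≠ 4 ∧ u ^ 2 - 3 * u + 1 ≠ 0)
    (q : ℕ) (T : TamLocal) (hTq : T.p = q) (hT : T.check ⟨a1, a2, a3, a4, a6⟩ = true) {c : ℕ}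
    (hvals : T.vals = [c]) {w : ℕ} (hw : w ≤ padicValNat p c) (hqp : q ≠ p)
    (hJ : JetchevDivisibilityCarrierNe)
    (hMcU : McCallum1991_padicValNat_card_sha_primary_add_le_of_globalDivisibility)
    (hGZK : rank_eq_analyticRank_of_analyticRank_le_one)
    (hKo : ∀ (N : ℕ) [NeZero N] (W : WeierstrassCurve ℚ) (K : Type) [Field K] [NumberField K], kolyvagin N W K)
    (hmod : exists_isNewformOf) (W : WeierstrassCurve ℚ) (hW : W = ⟨a1, a2, a3, a4, a6⟩) {N : ℕ}
    [NeZero N] {K : Type} [Field K] [NumberField K] (hK : IsImaginaryQuadratic K)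
    (hD3 : NumberField.discr K ≠ -3) (hD4 : NumberField.discr K ≠ -4)
    (hH : SatisfiesHeegnerHypothesis N K) {P : (W.baseChange K).toAffine.Point}
    (hP : IsHeegnerPoint N W K P) (hnt : ¬ IsOfFinAddOrder P) (hqN : q ∣ N)
    (hv : padicValNat p (AddSubgroup.zmultiples P).index ≤ w) (hr : W.analyticRank ≤ 1) {s : ℚ}
    (hs : shaAn W = (s : ℂ)) (hvs : padicValRat p s = 0) :
    BSDp W p :=
  bsdp_of_jetRowA5_tam_min
    (p := p) (hp := hp) (hp5 := hp5) (a1 := a1) (a2 := a2) (a3 := a3) (a4 := a4) (a6 := a6)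
    (hmin := hmin) (ℓ₁ := ℓ₁) (ℓ₂ := ℓ₂) (ℓ₃ := ℓ₃) (hℓ₁ := hℓ₁) (hℓ₂ := hℓ₂) (hℓ₃ := hℓ₃)
    (h2₁ := h2₁) (h2₂ := h2₂) (h2₃ := h2₃) (hne₁ := hne₁) (hne₂ := hne₂) (hne₃ := hne₃) (hΔ₁ := hΔ₁)
    (hΔ₂ := hΔ₂) (hΔ₃ := hΔ₃) (hc₁ := hc₁) (hc₂ := hc₂) (hc₃ := hc₃) (r := r) (u := u) (hi := hi)
    (hii := hii) (hiii := hiii) (q := q) (T := T) (hTq := hTq) (hT := hT) (hvals := hvals)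
    (hw := hw) (hqp := hqp) (hJ := hJ) (hMcU := hMcU) (hGZK := hGZK) (hKo := hKo)
    (hrec := heegnerPointOfConductor_one_galoisConj_forall)
    (hD36 := (fun N _ W K _ _ => phi_heegnerTau_mem_singularModuliField_holds N W K))
    (hlev := (level_eq_conductorNorm_forall_of_exists_isNewformOf hmod)) (W := W) (hW := hW)
    (hK := hK) (hD3 := hD3) (hD4 := hD4) (hH := hH) (hP := hP) (hnt := hnt) (hqN := hqN) (hv := hv)
    (hr := hr) (hs := hs) (hvs := hvs)

/-- **FED twin of `JET.bsdp_of_jetRowB5_tam_min`** — bucket B, `p ≥ 5`, carrier `q = p` split `I_n` (the kit's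
§1; 68 landed records): the door's statement with `hrec` / `hD36` SUPPLIED by the Literature theorems and
`hlev` by `hmod : exists_isNewformOf`; every other binder verbatim, by name. -/
theorem bsdp_of_jetRowB5_tam_min_fed
    (p : ℕ) (hp : p.Prime) (hp5 : 5 ≤ p) (a1 a2 a3 a4 a6 : ℤ)
    (hmin : (⟨a1, a2, a3, a4, a6⟩ : WeierstrassCurve ℚ).IsGloballyMinimal)
    (hpΔ : (p : ℤ) ∣ (⟨a1, a2, a3, a4, a6⟩ : WeierstrassCurve ℤ).Δ)
    (hpc₄ : ¬ (p : ℤ) ∣ (⟨a1, a2, a3, a4, a6⟩ : WeierstrassCurve ℤ).c₄) (ℓ₁ ℓ₂ ℓ₃ : ℕ)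
    (hℓ₁ : ℓ₁.Prime) (hℓ₂ : ℓ₂.Prime) (hℓ₃ : ℓ₃.Prime) (h2₁ : ℓ₁ ≠ 2) (h2₂ : ℓ₂ ≠ 2) (h2₃ : ℓ₃ ≠ 2)
    (hne₁ : ℓ₁ ≠ p) (hne₂ : ℓ₂ ≠ p) (hne₃ : ℓ₃ ≠ p) (hΔ₁ : ¬ (ℓ₁ : ℤ) ∣ discOf [a1, a2, a3, a4, a6])
    (hΔ₂ : ¬ (ℓ₂ : ℤ) ∣ discOf [a1, a2, a3, a4, a6])
    (hΔ₃ : ¬ (ℓ₃ : ℤ) ∣ discOf [a1, a2, a3, a4, a6]) {n₁ n₂ n₃ : ℕ}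
    (hc₁ : countPoints [a1, a2, a3, a4, a6] ℓ₁ = n₁)
    (hc₂ : countPoints [a1, a2, a3, a4, a6] ℓ₂ = n₂)
    (hc₃ : countPoints [a1, a2, a3, a4, a6] ℓ₃ = n₃) (r u : ZMod p)
    (hi : (((ℓ₁ : ℤ) + 1 - n₁ : ℤ) : ZMod p) ^ 2 - 4 * ℓ₁ = r * r ∧
      (((ℓ₁ : ℤ) + 1 - n₁ : ℤ) : ZMod p) ^ 2 - 4 * ℓ₁ ≠ 0 ∧ (((ℓ₁ : ℤ) + 1 - n₁ : ℤ) : ZMod p) ≠ 0)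
    (hii : ((((ℓ₂ : ℤ) + 1 - n₂ : ℤ) : ZMod p) ^ 2 - 4 * ℓ₂) ^ (p / 2) = -1 ∧
      (((ℓ₂ : ℤ) + 1 - n₂ : ℤ) : ZMod p) ≠ 0)
    (hiii : (((ℓ₃ : ℤ) + 1 - n₃ : ℤ) : ZMod p) ^ 2 = u * ℓ₃ ∧
      u ≠ 0 ∧ u ≠ 1 ∧ u ≠ 2 ∧ u ≠ 4 ∧ u ^ 2 - 3 * u + 1 ≠ 0)
    (T : TamLocal) (hTp : T.p = p) (hT : T.check ⟨a1, a2, a3, a4, a6⟩ = true) {c : ℕ}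
    (hvals : T.vals = [c]) {w : ℕ} (hw : w ≤ padicValNat p c) (hJ : JetchevDivisibilityCarrierMult)
    (hMcU : McCallum1991_padicValNat_card_sha_primary_add_le_of_globalDivisibility)
    (hGZK : rank_eq_analyticRank_of_analyticRank_le_one)
    (hKo : ∀ (N : ℕ) [NeZero N] (W : WeierstrassCurve ℚ) (K : Type) [Field K] [NumberField K], kolyvagin N W K)
    (hmod : exists_isNewformOf) (W : WeierstrassCurve ℚ) (hW : W = ⟨a1, a2, a3, a4, a6⟩) {N : ℕ}
    [NeZero N] {K : Type} [Field K] [NumberField K] (hK : IsImaginaryQuadratic K)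
    (hD3 : NumberField.discr K ≠ -3) (hD4 : NumberField.discr K ≠ -4)
    (hH : SatisfiesHeegnerHypothesis N K) {P : (W.baseChange K).toAffine.Point}
    (hP : IsHeegnerPoint N W K P) (hnt : ¬ IsOfFinAddOrder P)
    (hv : padicValNat p (AddSubgroup.zmultiples P).index ≤ w) (hr : W.analyticRank ≤ 1) {s : ℚ}
    (hs : shaAn W = (s : ℂ)) (hvs : padicValRat p s = 0) :
    BSDp W p :=
  bsdp_of_jetRowB5_tam_min
    (p := p) (hp := hp) (hp5 := hp5) (a1 := a1) (a2 := a2) (a3 := a3) (a4 := a4) (a6 := a6)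
    (hmin := hmin) (hpΔ := hpΔ) (hpc₄ := hpc₄) (ℓ₁ := ℓ₁) (ℓ₂ := ℓ₂) (ℓ₃ := ℓ₃) (hℓ₁ := hℓ₁)
    (hℓ₂ := hℓ₂) (hℓ₃ := hℓ₃) (h2₁ := h2₁) (h2₂ := h2₂) (h2₃ := h2₃) (hne₁ := hne₁) (hne₂ := hne₂)
    (hne₃ := hne₃) (hΔ₁ := hΔ₁) (hΔ₂ := hΔ₂) (hΔ₃ := hΔ₃) (hc₁ := hc₁) (hc₂ := hc₂) (hc₃ := hc₃)
    (r := r) (u := u) (hi := hi) (hii := hii) (hiii := hiii) (T := T) (hTp := hTp) (hT := hT)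
    (hvals := hvals) (hw := hw) (hJ := hJ) (hMcU := hMcU) (hGZK := hGZK) (hKo := hKo)
    (hrec := heegnerPointOfConductor_one_galoisConj_forall)
    (hD36 := (fun N _ W K _ _ => phi_heegnerTau_mem_singularModuliField_holds N W K))
    (hlev := (level_eq_conductorNorm_forall_of_exists_isNewformOf hmod)) (W := W) (hW := hW)
    (hK := hK) (hD3 := hD3) (hD4 := hD4) (hH := hH) (hP := hP) (hnt := hnt) (hv := hv) (hr := hr)
    (hs := hs) (hvs := hvs)

/-! ## §2 `p = 3` multiplicative at `3` (kit `CarrierReadingRecordsKit` §2) -/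
/-- **FED twin of `JET.bsdp_of_jetRowA3_tam_min`** — bucket A, `p = 3` multiplicative at `3`, carrier `q ≠ 3`
split multiplicative (the kit's §2): the door's statement with `hrec` / `hD36` SUPPLIED by the Literature
theorems and `hlev` by `hmod : exists_isNewformOf`; every other binder verbatim, by name. -/
theorem bsdp_of_jetRowA3_tam_min_fed
    (a1 a2 a3 a4 a6 : ℤ) (hmin : (⟨a1, a2, a3, a4, a6⟩ : WeierstrassCurve ℚ).IsGloballyMinimal)
    (h3Δ : (3 : ℤ) ∣ (⟨a1, a2, a3, a4, a6⟩ : WeierstrassCurve ℤ).Δ)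
    (h3c₄ : ¬ (3 : ℤ) ∣ (⟨a1, a2, a3, a4, a6⟩ : WeierstrassCurve ℤ).c₄) (ℓ₁ ℓ₂ : ℕ) (hℓ₁ : ℓ₁.Prime)
    (hℓ₂ : ℓ₂.Prime) (h2₁ : ℓ₁ ≠ 2) (h2₂ : ℓ₂ ≠ 2) (h3₁ : ℓ₁ ≠ 3) (h3₂ : ℓ₂ ≠ 3)
    (hΔ₁ : ¬ (ℓ₁ : ℤ) ∣ discOf [a1, a2, a3, a4, a6])
    (hΔ₂ : ¬ (ℓ₂ : ℤ) ∣ discOf [a1, a2, a3, a4, a6]) {n₁ n₂ : ℕ}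
    (hc₁ : countPoints [a1, a2, a3, a4, a6] ℓ₁ = n₁)
    (hc₂ : countPoints [a1, a2, a3, a4, a6] ℓ₂ = n₂)
    (hirr : ∀ t : ZMod 3, t ^ 2 - (((ℓ₁ : ℤ) + 1 - n₁ : ℤ) : ZMod 3) * t + ℓ₁ ≠ 0)
    (hdet₂ : (ℓ₂ : ZMod 3) = 1) (htr₂ : (((ℓ₂ : ℤ) + 1 - n₂ : ℤ) : ZMod 3) = 2) (hsq : ¬ 9 ∣ n₂)
    (q : ℕ) (T : TamLocal) (hTq : T.p = q) (hT : T.check ⟨a1, a2, a3, a4, a6⟩ = true) {c : ℕ}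
    (hvals : T.vals = [c]) {w : ℕ} (hw : w ≤ padicValNat 3 c) (hq3 : q ≠ 3)
    (hJ : JetchevDivisibilityCarrierNe)
    (hMcU : McCallum1991_padicValNat_card_sha_primary_add_le_of_globalDivisibility)
    (hGZK : rank_eq_analyticRank_of_analyticRank_le_one)
    (hKo : ∀ (N : ℕ) [NeZero N] (W : WeierstrassCurve ℚ) (K : Type) [Field K] [NumberField K], kolyvagin N W K)
    (hmod : exists_isNewformOf) (W : WeierstrassCurve ℚ) (hW : W = ⟨a1, a2, a3, a4, a6⟩) {N : ℕ}
    [NeZero N] {K : Type} [Field K] [NumberField K] (hK : IsImaginaryQuadratic K)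
    (hD3 : NumberField.discr K ≠ -3) (hD4 : NumberField.discr K ≠ -4)
    (hH : SatisfiesHeegnerHypothesis N K) {P : (W.baseChange K).toAffine.Point}
    (hP : IsHeegnerPoint N W K P) (hnt : ¬ IsOfFinAddOrder P) (hqN : q ∣ N)
    (hv : padicValNat 3 (AddSubgroup.zmultiples P).index ≤ w) (hr : W.analyticRank ≤ 1) {s : ℚ}
    (hs : shaAn W = (s : ℂ)) (hvs : padicValRat 3 s = 0) :
    BSDp W 3 :=
  bsdp_of_jetRowA3_tam_min
    (a1 := a1) (a2 := a2) (a3 := a3) (a4 := a4) (a6 := a6) (hmin := hmin) (h3Δ := h3Δ)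
    (h3c₄ := h3c₄) (ℓ₁ := ℓ₁) (ℓ₂ := ℓ₂) (hℓ₁ := hℓ₁) (hℓ₂ := hℓ₂) (h2₁ := h2₁) (h2₂ := h2₂)
    (h3₁ := h3₁) (h3₂ := h3₂) (hΔ₁ := hΔ₁) (hΔ₂ := hΔ₂) (hc₁ := hc₁) (hc₂ := hc₂) (hirr := hirr)
    (hdet₂ := hdet₂) (htr₂ := htr₂) (hsq := hsq) (q := q) (T := T) (hTq := hTq) (hT := hT)
    (hvals := hvals) (hw := hw) (hq3 := hq3) (hJ := hJ) (hMcU := hMcU) (hGZK := hGZK) (hKo := hKo)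
    (hrec := heegnerPointOfConductor_one_galoisConj_forall)
    (hD36 := (fun N _ W K _ _ => phi_heegnerTau_mem_singularModuliField_holds N W K))
    (hlev := (level_eq_conductorNorm_forall_of_exists_isNewformOf hmod)) (W := W) (hW := hW)
    (hK := hK) (hD3 := hD3) (hD4 := hD4) (hH := hH) (hP := hP) (hnt := hnt) (hqN := hqN) (hv := hv)
    (hr := hr) (hs := hs) (hvs := hvs)

/-- **FED twin of `JET.bsdp_of_jetRowA3_tamX_min`** — bucket A, `p = 3` multiplicative at `3`, carrier `q ≠ 3`
of type `IV`/`IV*` (the kit's §2): the door's statement with `hrec` / `hD36` SUPPLIED by the Literature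
theorems and `hlev` by `hmod : exists_isNewformOf`; every other binder verbatim, by name. -/
theorem bsdp_of_jetRowA3_tamX_min_fed
    (a1 a2 a3 a4 a6 : ℤ) (hmin : (⟨a1, a2, a3, a4, a6⟩ : WeierstrassCurve ℚ).IsGloballyMinimal)
    (h3Δ : (3 : ℤ) ∣ (⟨a1, a2, a3, a4, a6⟩ : WeierstrassCurve ℤ).Δ)
    (h3c₄ : ¬ (3 : ℤ) ∣ (⟨a1, a2, a3, a4, a6⟩ : WeierstrassCurve ℤ).c₄) (ℓ₁ ℓ₂ : ℕ) (hℓ₁ : ℓ₁.Prime)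
    (hℓ₂ : ℓ₂.Prime) (h2₁ : ℓ₁ ≠ 2) (h2₂ : ℓ₂ ≠ 2) (h3₁ : ℓ₁ ≠ 3) (h3₂ : ℓ₂ ≠ 3)
    (hΔ₁ : ¬ (ℓ₁ : ℤ) ∣ discOf [a1, a2, a3, a4, a6])
    (hΔ₂ : ¬ (ℓ₂ : ℤ) ∣ discOf [a1, a2, a3, a4, a6]) {n₁ n₂ : ℕ}
    (hc₁ : countPoints [a1, a2, a3, a4, a6] ℓ₁ = n₁)
    (hc₂ : countPoints [a1, a2, a3, a4, a6] ℓ₂ = n₂)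
    (hirr : ∀ t : ZMod 3, t ^ 2 - (((ℓ₁ : ℤ) + 1 - n₁ : ℤ) : ZMod 3) * t + ℓ₁ ≠ 0)
    (hdet₂ : (ℓ₂ : ZMod 3) = 1) (htr₂ : (((ℓ₂ : ℤ) + 1 - n₂ : ℤ) : ZMod 3) = 2) (hsq : ¬ 9 ∣ n₂)
    (q : ℕ) (hq : q.Prime) (F : TamX) (hFq : F.p = q) (hF : F.check ⟨a1, a2, a3, a4, a6⟩ = true)
    {w : ℕ} (hw : w ≤ padicValNat 3 F.c) (hq3 : q ≠ 3) (hJ : JetchevDivisibilityCarrierNe)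
    (hMcU : McCallum1991_padicValNat_card_sha_primary_add_le_of_globalDivisibility)
    (hGZK : rank_eq_analyticRank_of_analyticRank_le_one)
    (hKo : ∀ (N : ℕ) [NeZero N] (W : WeierstrassCurve ℚ) (K : Type) [Field K] [NumberField K], kolyvagin N W K)
    (hmod : exists_isNewformOf) (W : WeierstrassCurve ℚ) (hW : W = ⟨a1, a2, a3, a4, a6⟩) {N : ℕ}
    [NeZero N] {K : Type} [Field K] [NumberField K] (hK : IsImaginaryQuadratic K)
    (hD3 : NumberField.discr K ≠ -3) (hD4 : NumberField.discr K ≠ -4)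
    (hH : SatisfiesHeegnerHypothesis N K) {P : (W.baseChange K).toAffine.Point}
    (hP : IsHeegnerPoint N W K P) (hnt : ¬ IsOfFinAddOrder P) (hqN : q ∣ N)
    (hv : padicValNat 3 (AddSubgroup.zmultiples P).index ≤ w) (hr : W.analyticRank ≤ 1) {s : ℚ}
    (hs : shaAn W = (s : ℂ)) (hvs : padicValRat 3 s = 0) :
    BSDp W 3 :=
  bsdp_of_jetRowA3_tamX_min
    (a1 := a1) (a2 := a2) (a3 := a3) (a4 := a4) (a6 := a6) (hmin := hmin) (h3Δ := h3Δ)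
    (h3c₄ := h3c₄) (ℓ₁ := ℓ₁) (ℓ₂ := ℓ₂) (hℓ₁ := hℓ₁) (hℓ₂ := hℓ₂) (h2₁ := h2₁) (h2₂ := h2₂)
    (h3₁ := h3₁) (h3₂ := h3₂) (hΔ₁ := hΔ₁) (hΔ₂ := hΔ₂) (hc₁ := hc₁) (hc₂ := hc₂) (hirr := hirr)
    (hdet₂ := hdet₂) (htr₂ := htr₂) (hsq := hsq) (q := q) (hq := hq) (F := F) (hFq := hFq)
    (hF := hF) (hw := hw) (hq3 := hq3) (hJ := hJ) (hMcU := hMcU) (hGZK := hGZK) (hKo := hKo)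
    (hrec := heegnerPointOfConductor_one_galoisConj_forall)
    (hD36 := (fun N _ W K _ _ => phi_heegnerTau_mem_singularModuliField_holds N W K))
    (hlev := (level_eq_conductorNorm_forall_of_exists_isNewformOf hmod)) (W := W) (hW := hW)
    (hK := hK) (hD3 := hD3) (hD4 := hD4) (hH := hH) (hP := hP) (hnt := hnt) (hqN := hqN) (hv := hv)
    (hr := hr) (hs := hs) (hvs := hvs)

/-- **FED twin of `JET.bsdp_of_jetRowB3_tam_min`** — bucket B, `p = 3`, carrier `3` split `I_{3k}` (the kit's
§2; 18 landed records): the door's statement with `hrec` / `hD36` SUPPLIED by the Literature theorems and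
`hlev` by `hmod : exists_isNewformOf`; every other binder verbatim, by name. -/
theorem bsdp_of_jetRowB3_tam_min_fed
    (a1 a2 a3 a4 a6 : ℤ) (hmin : (⟨a1, a2, a3, a4, a6⟩ : WeierstrassCurve ℚ).IsGloballyMinimal)
    (h3Δ : (3 : ℤ) ∣ (⟨a1, a2, a3, a4, a6⟩ : WeierstrassCurve ℤ).Δ)
    (h3c₄ : ¬ (3 : ℤ) ∣ (⟨a1, a2, a3, a4, a6⟩ : WeierstrassCurve ℤ).c₄) (ℓ₁ ℓ₂ : ℕ) (hℓ₁ : ℓ₁.Prime)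
    (hℓ₂ : ℓ₂.Prime) (h2₁ : ℓ₁ ≠ 2) (h2₂ : ℓ₂ ≠ 2) (h3₁ : ℓ₁ ≠ 3) (h3₂ : ℓ₂ ≠ 3)
    (hΔ₁ : ¬ (ℓ₁ : ℤ) ∣ discOf [a1, a2, a3, a4, a6])
    (hΔ₂ : ¬ (ℓ₂ : ℤ) ∣ discOf [a1, a2, a3, a4, a6]) {n₁ n₂ : ℕ}
    (hc₁ : countPoints [a1, a2, a3, a4, a6] ℓ₁ = n₁)
    (hc₂ : countPoints [a1, a2, a3, a4, a6] ℓ₂ = n₂)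
    (hirr : ∀ t : ZMod 3, t ^ 2 - (((ℓ₁ : ℤ) + 1 - n₁ : ℤ) : ZMod 3) * t + ℓ₁ ≠ 0)
    (hdet₂ : (ℓ₂ : ZMod 3) = 1) (htr₂ : (((ℓ₂ : ℤ) + 1 - n₂ : ℤ) : ZMod 3) = 2) (hsq : ¬ 9 ∣ n₂)
    (T : TamLocal) (hT3 : T.p = 3) (hT : T.check ⟨a1, a2, a3, a4, a6⟩ = true) {c : ℕ}
    (hvals : T.vals = [c]) {w : ℕ} (hw : w ≤ padicValNat 3 c) (hJ : JetchevDivisibilityCarrierMult)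
    (hMcU : McCallum1991_padicValNat_card_sha_primary_add_le_of_globalDivisibility)
    (hGZK : rank_eq_analyticRank_of_analyticRank_le_one)
    (hKo : ∀ (N : ℕ) [NeZero N] (W : WeierstrassCurve ℚ) (K : Type) [Field K] [NumberField K], kolyvagin N W K)
    (hmod : exists_isNewformOf) (W : WeierstrassCurve ℚ) (hW : W = ⟨a1, a2, a3, a4, a6⟩) {N : ℕ}
    [NeZero N] {K : Type} [Field K] [NumberField K] (hK : IsImaginaryQuadratic K)
    (hD3 : NumberField.discr K ≠ -3) (hD4 : NumberField.discr K ≠ -4)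
    (hH : SatisfiesHeegnerHypothesis N K) {P : (W.baseChange K).toAffine.Point}
    (hP : IsHeegnerPoint N W K P) (hnt : ¬ IsOfFinAddOrder P)
    (hv : padicValNat 3 (AddSubgroup.zmultiples P).index ≤ w) (hr : W.analyticRank ≤ 1) {s : ℚ}
    (hs : shaAn W = (s : ℂ)) (hvs : padicValRat 3 s = 0) :
    BSDp W 3 :=
  bsdp_of_jetRowB3_tam_min
    (a1 := a1) (a2 := a2) (a3 := a3) (a4 := a4) (a6 := a6) (hmin := hmin) (h3Δ := h3Δ)
    (h3c₄ := h3c₄) (ℓ₁ := ℓ₁) (ℓ₂ := ℓ₂) (hℓ₁ := hℓ₁) (hℓ₂ := hℓ₂) (h2₁ := h2₁) (h2₂ := h2₂)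
    (h3₁ := h3₁) (h3₂ := h3₂) (hΔ₁ := hΔ₁) (hΔ₂ := hΔ₂) (hc₁ := hc₁) (hc₂ := hc₂) (hirr := hirr)
    (hdet₂ := hdet₂) (htr₂ := htr₂) (hsq := hsq) (T := T) (hT3 := hT3) (hT := hT) (hvals := hvals)
    (hw := hw) (hJ := hJ) (hMcU := hMcU) (hGZK := hGZK) (hKo := hKo)
    (hrec := heegnerPointOfConductor_one_galoisConj_forall)
    (hD36 := (fun N _ W K _ _ => phi_heegnerTau_mem_singularModuliField_holds N W K))
    (hlev := (level_eq_conductorNorm_forall_of_exists_isNewformOf hmod)) (W := W) (hW := hW)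
    (hK := hK) (hD3 := hD3) (hD4 := hD4) (hH := hH) (hP := hP) (hnt := hnt) (hv := hv) (hr := hr)
    (hs := hs) (hvs := hvs)

/-! ## §3 `p = 3`, ANY reduction at `3` on the A side (kit `CarrierReadingRecordsKitThree`) -/
/-- **FED twin of `JET.bsdp_of_jetRowA3F_tam_min`** — bucket A, `p = 3` ANY reduction at `3`, carrier `q ≠ 3`
split multiplicative, tower by one mod-`9` Frobenius witness (KitThree §1; 31 landed records): the door's
statement with `hrec` / `hD36` SUPPLIED by the Literature theorems and `hlev` by `hmod :
exists_isNewformOf`; every other binder verbatim, by name. -/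
theorem bsdp_of_jetRowA3F_tam_min_fed
    (a1 a2 a3 a4 a6 : ℤ) (hmin : (⟨a1, a2, a3, a4, a6⟩ : WeierstrassCurve ℚ).IsGloballyMinimal)
    (ℓ₁ ℓ₂ : ℕ) (hℓ₁ : ℓ₁.Prime) (hℓ₂ : ℓ₂.Prime) (h2₁ : ℓ₁ ≠ 2) (h2₂ : ℓ₂ ≠ 2) (h3₁ : ℓ₁ ≠ 3)
    (h3₂ : ℓ₂ ≠ 3) (hΔ₁ : ¬ (ℓ₁ : ℤ) ∣ discOf [a1, a2, a3, a4, a6])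
    (hΔ₂ : ¬ (ℓ₂ : ℤ) ∣ discOf [a1, a2, a3, a4, a6]) {n₁ n₂ : ℕ}
    (hc₁ : countPoints [a1, a2, a3, a4, a6] ℓ₁ = n₁)
    (hc₂ : countPoints [a1, a2, a3, a4, a6] ℓ₂ = n₂)
    (hirr : ∀ t : ZMod 3, t ^ 2 - (((ℓ₁ : ℤ) + 1 - n₁ : ℤ) : ZMod 3) * t + ℓ₁ ≠ 0)
    (hdet₂ : (ℓ₂ : ZMod 3) = 1) (htr₂ : (((ℓ₂ : ℤ) + 1 - n₂ : ℤ) : ZMod 3) = 2) (hsq : ¬ 9 ∣ n₂)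
    (ℓ₉ : ℕ) (hℓ₉ : ℓ₉.Prime) (h2₉ : ℓ₉ ≠ 2)
    (hΔ₉ : ¬ (ℓ₉ : ℤ) ∣ (⟨a1, a2, a3, a4, a6⟩ : WeierstrassCurve ℤ).Δ) {n₉ : ℕ}
    (hc₉ : countPoints [a1, a2, a3, a4, a6] ℓ₉ = n₉) (hℓ9 : ℓ₉ % 9 = 2 ∨ ℓ₉ % 9 = 5)
    (ha9 : ((ℓ₉ : ℤ) + 1 - n₉) % 9 = 3 ∨ ((ℓ₉ : ℤ) + 1 - n₉) % 9 = 6) (q : ℕ) (T : TamLocal)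
    (hTq : T.p = q) (hT : T.check ⟨a1, a2, a3, a4, a6⟩ = true) {c : ℕ} (hvals : T.vals = [c])
    {w : ℕ} (hw : w ≤ padicValNat 3 c) (hq3 : q ≠ 3) (hJ : JetchevDivisibilityCarrierNe)
    (hMcU : McCallum1991_padicValNat_card_sha_primary_add_le_of_globalDivisibility)
    (hGZK : rank_eq_analyticRank_of_analyticRank_le_one)
    (hKo : ∀ (N : ℕ) [NeZero N] (W : WeierstrassCurve ℚ) (K : Type) [Field K] [NumberField K], kolyvagin N W K)
    (hmod : exists_isNewformOf) (W : WeierstrassCurve ℚ) (hW : W = ⟨a1, a2, a3, a4, a6⟩) {N : ℕ}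
    [NeZero N] {K : Type} [Field K] [NumberField K] (hK : IsImaginaryQuadratic K)
    (hD3 : NumberField.discr K ≠ -3) (hD4 : NumberField.discr K ≠ -4)
    (hH : SatisfiesHeegnerHypothesis N K) {P : (W.baseChange K).toAffine.Point}
    (hP : IsHeegnerPoint N W K P) (hnt : ¬ IsOfFinAddOrder P) (hqN : q ∣ N)
    (hv : padicValNat 3 (AddSubgroup.zmultiples P).index ≤ w) (hr : W.analyticRank ≤ 1) {s : ℚ}
    (hs : shaAn W = (s : ℂ)) (hvs : padicValRat 3 s = 0) :
    BSDp W 3 :=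
  bsdp_of_jetRowA3F_tam_min
    (a1 := a1) (a2 := a2) (a3 := a3) (a4 := a4) (a6 := a6) (hmin := hmin) (ℓ₁ := ℓ₁) (ℓ₂ := ℓ₂)
    (hℓ₁ := hℓ₁) (hℓ₂ := hℓ₂) (h2₁ := h2₁) (h2₂ := h2₂) (h3₁ := h3₁) (h3₂ := h3₂) (hΔ₁ := hΔ₁)
    (hΔ₂ := hΔ₂) (hc₁ := hc₁) (hc₂ := hc₂) (hirr := hirr) (hdet₂ := hdet₂) (htr₂ := htr₂)
    (hsq := hsq) (ℓ₉ := ℓ₉) (hℓ₉ := hℓ₉) (h2₉ := h2₉) (hΔ₉ := hΔ₉) (hc₉ := hc₉) (hℓ9 := hℓ9)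
    (ha9 := ha9) (q := q) (T := T) (hTq := hTq) (hT := hT) (hvals := hvals) (hw := hw) (hq3 := hq3)
    (hJ := hJ) (hMcU := hMcU) (hGZK := hGZK) (hKo := hKo)
    (hrec := heegnerPointOfConductor_one_galoisConj_forall)
    (hD36 := (fun N _ W K _ _ => phi_heegnerTau_mem_singularModuliField_holds N W K))
    (hlev := (level_eq_conductorNorm_forall_of_exists_isNewformOf hmod)) (W := W) (hW := hW)
    (hK := hK) (hD3 := hD3) (hD4 := hD4) (hH := hH) (hP := hP) (hnt := hnt) (hqN := hqN) (hv := hv)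
    (hr := hr) (hs := hs) (hvs := hvs)

/-- **FED twin of `JET.bsdp_of_jetRowA3F_tamX_min`** — bucket A, `p = 3` ANY reduction, carrier `q ≠ 3` of type
`IV`/`IV*`, mod-`9` witness (KitThree §2; 6 landed records): the door's statement with `hrec` / `hD36`
SUPPLIED by the Literature theorems and `hlev` by `hmod : exists_isNewformOf`; every other binder verbatim,
by name. -/
theorem bsdp_of_jetRowA3F_tamX_min_fed
    (a1 a2 a3 a4 a6 : ℤ) (hmin : (⟨a1, a2, a3, a4, a6⟩ : WeierstrassCurve ℚ).IsGloballyMinimal)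
    (ℓ₁ ℓ₂ : ℕ) (hℓ₁ : ℓ₁.Prime) (hℓ₂ : ℓ₂.Prime) (h2₁ : ℓ₁ ≠ 2) (h2₂ : ℓ₂ ≠ 2) (h3₁ : ℓ₁ ≠ 3)
    (h3₂ : ℓ₂ ≠ 3) (hΔ₁ : ¬ (ℓ₁ : ℤ) ∣ discOf [a1, a2, a3, a4, a6])
    (hΔ₂ : ¬ (ℓ₂ : ℤ) ∣ discOf [a1, a2, a3, a4, a6]) {n₁ n₂ : ℕ}
    (hc₁ : countPoints [a1, a2, a3, a4, a6] ℓ₁ = n₁)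
    (hc₂ : countPoints [a1, a2, a3, a4, a6] ℓ₂ = n₂)
    (hirr : ∀ t : ZMod 3, t ^ 2 - (((ℓ₁ : ℤ) + 1 - n₁ : ℤ) : ZMod 3) * t + ℓ₁ ≠ 0)
    (hdet₂ : (ℓ₂ : ZMod 3) = 1) (htr₂ : (((ℓ₂ : ℤ) + 1 - n₂ : ℤ) : ZMod 3) = 2) (hsq : ¬ 9 ∣ n₂)
    (ℓ₉ : ℕ) (hℓ₉ : ℓ₉.Prime) (h2₉ : ℓ₉ ≠ 2)
    (hΔ₉ : ¬ (ℓ₉ : ℤ) ∣ (⟨a1, a2, a3, a4, a6⟩ : WeierstrassCurve ℤ).Δ) {n₉ : ℕ}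
    (hc₉ : countPoints [a1, a2, a3, a4, a6] ℓ₉ = n₉) (hℓ9 : ℓ₉ % 9 = 2 ∨ ℓ₉ % 9 = 5)
    (ha9 : ((ℓ₉ : ℤ) + 1 - n₉) % 9 = 3 ∨ ((ℓ₉ : ℤ) + 1 - n₉) % 9 = 6) (q : ℕ) (hq : q.Prime)
    (F : TamX) (hFq : F.p = q) (hF : F.check ⟨a1, a2, a3, a4, a6⟩ = true) {w : ℕ}
    (hw : w ≤ padicValNat 3 F.c) (hq3 : q ≠ 3) (hJ : JetchevDivisibilityCarrierNe)
    (hMcU : McCallum1991_padicValNat_card_sha_primary_add_le_of_globalDivisibility)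
    (hGZK : rank_eq_analyticRank_of_analyticRank_le_one)
    (hKo : ∀ (N : ℕ) [NeZero N] (W : WeierstrassCurve ℚ) (K : Type) [Field K] [NumberField K], kolyvagin N W K)
    (hmod : exists_isNewformOf) (W : WeierstrassCurve ℚ) (hW : W = ⟨a1, a2, a3, a4, a6⟩) {N : ℕ}
    [NeZero N] {K : Type} [Field K] [NumberField K] (hK : IsImaginaryQuadratic K)
    (hD3 : NumberField.discr K ≠ -3) (hD4 : NumberField.discr K ≠ -4)
    (hH : SatisfiesHeegnerHypothesis N K) {P : (W.baseChange K).toAffine.Point}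
    (hP : IsHeegnerPoint N W K P) (hnt : ¬ IsOfFinAddOrder P) (hqN : q ∣ N)
    (hv : padicValNat 3 (AddSubgroup.zmultiples P).index ≤ w) (hr : W.analyticRank ≤ 1) {s : ℚ}
    (hs : shaAn W = (s : ℂ)) (hvs : padicValRat 3 s = 0) :
    BSDp W 3 :=
  bsdp_of_jetRowA3F_tamX_min
    (a1 := a1) (a2 := a2) (a3 := a3) (a4 := a4) (a6 := a6) (hmin := hmin) (ℓ₁ := ℓ₁) (ℓ₂ := ℓ₂)
    (hℓ₁ := hℓ₁) (hℓ₂ := hℓ₂) (h2₁ := h2₁) (h2₂ := h2₂) (h3₁ := h3₁) (h3₂ := h3₂) (hΔ₁ := hΔ₁)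
    (hΔ₂ := hΔ₂) (hc₁ := hc₁) (hc₂ := hc₂) (hirr := hirr) (hdet₂ := hdet₂) (htr₂ := htr₂)
    (hsq := hsq) (ℓ₉ := ℓ₉) (hℓ₉ := hℓ₉) (h2₉ := h2₉) (hΔ₉ := hΔ₉) (hc₉ := hc₉) (hℓ9 := hℓ9)
    (ha9 := ha9) (q := q) (hq := hq) (F := F) (hFq := hFq) (hF := hF) (hw := hw) (hq3 := hq3)
    (hJ := hJ) (hMcU := hMcU) (hGZK := hGZK) (hKo := hKo)
    (hrec := heegnerPointOfConductor_one_galoisConj_forall)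
    (hD36 := (fun N _ W K _ _ => phi_heegnerTau_mem_singularModuliField_holds N W K))
    (hlev := (level_eq_conductorNorm_forall_of_exists_isNewformOf hmod)) (W := W) (hW := hW)
    (hK := hK) (hD3 := hD3) (hD4 := hD4) (hH := hH) (hP := hP) (hnt := hnt) (hqN := hqN) (hv := hv)
    (hr := hr) (hs := hs) (hvs := hvs)

end Summit.BirchSwinnertonDyer.Rank1Residual.JET
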